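import Summits.ResolutionOfSingularities.ResolutionOfSingularities.Theses.PAlteration
import Summits.ResolutionOfSingularities.ResolutionOfSingularities.Theorems.PAlterationPicoverOfDegP
import Literature.AlgebraicGeometry.Resolution.KummerNormalForm
import Literature.AlgebraicGeometry.Resolution.LogRegularAtlas
import Literature.AlgebraicGeometry.Resolution.LogRegularAtlasGluing
import Literature.AlgebraicGeometry.Resolution.DivisorialMonoid
import Literature.AlgebraicGeometry.Resolution.NormalizationInExtension
import Summits.ResolutionOfSingularities.ResolutionOfSingularities.Theorems.PAlterationPicoverSectionsNormalizationInRoot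
import Summits.ResolutionOfSingularities.ResolutionOfSingularities.Theorems.PAlterationPicoverLocalChartSepWoundCentre
import Summits.ResolutionOfSingularities.ResolutionOfSingularities.Theorems.PAlterationPicoverLocalChartSepKummerCentre
import HarnessLib

/-!
# Crux `Picover` (stmt-ResolutionOfSingularities-0554), line `giraud-separated-base` — the
# CONDITIONAL BRIDGE `Picover ⟸ GiraudNormalFormSep ∧ Kato 1994 (10.4)` (sorry-free)

The line `giraud-separated-base` ("normalise the radicand on the separated REGULAR base, never the
cover"; Giraud 1983, Cossart 1987; registered skeleton `Cruxes/Picover/Lines/giraud_separated_base.lean`)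
reduces the crux `PAlteration.Picover` to exactly two statements:

* `GiraudNormalFormSep` — the RESEARCH content (Giraud's normal-form conjecture for the class of a
  height-one purely inseparable extension on a separated regular base, uniform-sections format;
  printed for `dim W ≤ 3`, open for `dim W ≥ 4` = `DimensionFourFrontier`), taken here as the
  hypothesis `hGNF` (its statement is the registered stub `stub_giraudNormalFormSep` verbatim);
* `Kato1994_logRegular_hasResolution_general` — the NAMED FACT Kato 1994 (10.4) / Nizioł 2006
  Thm. 5.8 (a scheme with a log-regular Zariski fs atlas has a resolution), hypothesis `hKato`.

Everything else is PROVED: the local log-regular charts on the normalised cover (`localChartsSep`: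
dispatch on the alternative of the normal form at the centre to
`LocalChartSepWoundCentre.localChartSep_woundCentre` / `LocalChartSepKummerCentre.localChartSep_kummerCentre`
— crux 0557's pointwise chart algebra for an abstract cover — fed with the sections package
`SectionsNormalizationInRoot.sections_normalizationIn_of_root`), the atlas (`endgameAtlasSep`,
glued by `logRegularAtlas_of_localLogRegularChart` on `W'^L` itself), the descent of the resolution
along `W'^L → W^L` and the degree-`p` tower (`OfDegP.picover_of_picoverDegP`). This is the 0554
twin of 0557's bridge `GiraudReduction.picoverLocalModel_of_normalForm_of_atlas`.
-/

noncomputable section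

set_option linter.dupNamespace false

open CategoryTheory CategoryTheory.Limits AlgebraicGeometry TopologicalSpace Polynomial
open Literature.AlgebraicGeometry.Resolution Literature.AlgebraicGeometry.Motives
open Summit.ResolutionOfSingularities.ResolutionOfSingularities.Theorems.Picover

namespace Summit.ResolutionOfSingularities.ResolutionOfSingularities.Theorems.Picover.GiraudSepReduction

/-- STUB — THE ENDGAME, ALGEBRAIC HALF, LOCAL FORM (printed algebra, Lean-heavy; the separated
twin of the 0557 line's pointwise `stub_localCharts` — Giraud 1983 Prop. 1.5, Kato 1994
Thm. 11.6 / (3.1); tree inputs: `Theorems.Picover.StalkNormalizationIn` (stalk of `W'^L` at `y`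
= integral closure of `𝒪_{W',w'}` in `L`, p137224), `Theorems.PicoverLocalModel.KummerTwist`,
`….WoundTwistParameters`, `….WoundTwistIntegralClosure`, `….KummerToricClosure`,
`….BoundaryTypes`, `Literature.….LogRegularAtlasGluing`, `Literature.….DivisorialMonoid`).
**Local log-regular charts on the normalised cover of a `p`-th-root class in Giraud normal
form.** Data: `W` integral, locally of finite type over `k`, `L/K(W)` purely inseparable of degree
`p`; `ρ : W' → W` proper birational with `W'` integral regular, `E` an snc boundary on `W'`, `L`
regarded as a `K(W')`-algebra compatibly with `ρ^♯ : K(W) → K(W')`; the class of `L` in Giraud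
normal form along `E` locally uniformly on `W'` (sections `a` on affine opens with normal form at
every point of the open, as in `stub_giraudNormalFormSep`). It is assembled (lead a3, after the
0557 chain landed its `stub_localCharts`) from the registered helper stubs
`sections_normalizationIn_of_root` (cover-side package: `Γ(W'^L, ι⁻¹V) =` integral closure of
`Γ(W', V)` in `L`, generated by the `p`-th root up to denominators),
`localChartSep_woundCentre` / `localChartSep_kummerCentre` (the 0557 assemblies
`localChart_woundCentre` / `localChart_kummerCentre` for an ABSTRACT cover `Z → W'` with that
package) and `pointData_giraudNormalFormAt_of_pointwise` (p147267). Conclusion: every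
point `y` of `W'^L = normalizationIn W' L` has an affine neighbourhood with ONE fs chart, log
regular at every prime, whose stalk monoids are the boundary log structure of `ι⁻¹ E`
(`ι : W'^L → W'`): the `divisorialMonoid` of the extension to `𝒪_{W'^L,y}` of the product of
the stalk ideals at `ι y` of the members of `E` (the germs invertible off the preimage of
`⋃ E`). Over a wound/transversal point `w'` the stalk of `W'^L` is the wound twist
`𝒪_{W',w'}[t']/(t'^p - u)` (regular, the `x_j` still parameters; chart `ℕ^r → (x_j)`); over a
Kummer point, after the twist `w = t^α x_{j₀}^β` (`α A_{j₀} + β p = 1`), it is the toric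
`⊕_{i<p} 𝒪_{W',w'}·w^i/x^{⌊iA'/p⌋}` with chart the saturation of `⟨e_1, …, e_r, (Σ A'_j e_j)/p⟩`,
log regular at every prime (Kato (2.1)); all charts generate the divisorial log structure of the
reduced preimage of `E`, so neighbouring charts are compatible by construction.
[cite: Giraud1983, Prop. 1.5] [cite: Kato1994, Thm. 11.6] -/
theorem localChartsSep : ∀ (p : ℕ) [Fact p.Prime] (k : Type) [Field k] [CharP k p]
    (W : Scheme.{0}) [IsIntegral W] (f : W ⟶ Spec (.of k)) [LocallyOfFiniteType f]
    (L : Type) [Field L] [Algebra W.functionField L] [FiniteDimensional W.functionField L]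
    (W' : Scheme.{0}) [IsIntegral W'] (ρ : W' ⟶ W) [IsProper ρ] [IsDominant ρ]
    (E : List W'.IdealSheafData) [Algebra W'.functionField L],
    (algebraMap W'.functionField L).comp (RatFn.functionFieldMap ρ) =
      algebraMap W.functionField L →
    IsBirational ρ → Scheme.IsRegular W' → HasSNC E →
    IsPurelyInseparable W.functionField L → Module.finrank W.functionField L = p →
    (∀ w' : W', ∃ (U : W'.affineOpens) (hU : w' ∈ (U : W'.Opens)) (a : Γ(W', (U : W'.Opens))),
        (∃ (y : L) (c : W.functionField), y ∉ (algebraMap W.functionField L).range ∧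
          y ^ p = algebraMap W.functionField L c ∧
          RatFn.functionFieldMap ρ c =
            algebraMap (W'.presheaf.stalk w') W'.functionField
              (W'.presheaf.germ (U : W'.Opens) w' hU a)) ∧
        ∀ (w'' : W') (hw'' : w'' ∈ (U : W'.Opens)), ∃ (r : ℕ)
          (D : Fin r → {D : W'.IdealSheafData // D ∈ E ∧ w'' ∈ D.support})
          (x : Fin r → W'.presheaf.stalk w''), Function.Bijective D ∧
          (∀ j, stalkIdeal (D j).1 w'' = Ideal.span {x j}) ∧
          GiraudNormalFormAt p x (W'.presheaf.germ (U : W'.Opens) w'' hw'' a)) →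
    ∀ y : ↥(normalizationIn W' L),
      Nonempty (LocalLogRegularChart (normalizationIn W' L)
        (fun y => divisorialMonoid (((E.map fun D => stalkIdeal D ((normalizationInι W' L).base
          y))).prod.map ((normalizationInι W' L).stalkMap y).hom)) y) := by
  intro p _ k _ _ W _ f _ L _ _ _ W' _ ρ _ _ E _ hcompat hbir hW'reg hE hPI hdeg hNF y
  classical
  have hp : p.Prime := Fact.out
  set ι := normalizationInι W' L with hι
  -- `L` over `K(W')`: same range, purely inseparable, degree `p`
  have hbij : Function.Bijective (RatFn.functionFieldMap ρ) :=
    TowerTransport.bijective_functionFieldMap_of_isIso ρ hbir.isIso_stalkMap_genericPoint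
  let e : W.functionField ≃+* W'.functionField := RingEquiv.ofBijective _ hbij
  have halg : algebraMap W'.functionField L =
      (algebraMap W.functionField L).comp e.symm.toRingHom := by
    refine RingHom.ext fun x => ?_
    rw [RingHom.comp_apply, ← hcompat, RingHom.comp_apply]
    exact congrArg (algebraMap W'.functionField L) (e.apply_symm_apply x).symm
  have hrange : (algebraMap W'.functionField L).range = (algebraMap W.functionField L).range := by
    ext z
    simp only [RingHom.mem_range]
    constructor
    · rintro ⟨x, rfl⟩
      exact ⟨e.symm x, by rw [halg]; rfl⟩
    · rintro ⟨x, rfl⟩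
      exact ⟨e x, by rw [← hcompat]; rfl⟩
  have hdeg' : Module.finrank W'.functionField L = p := by
    rw [← hdeg]
    exact Algebra.finrank_eq_of_equiv_equiv e.symm (RingEquiv.refl L) (by ext x; simp [halg])
  haveI : CharP W.functionField p := by
    haveI : Nonempty (⊤ : W.Opens) := ⟨⟨genericPoint W, trivial⟩⟩
    let φ : k →+* W.functionField :=
      (W.germToFunctionField ⊤).hom.comp ((f.appTop).hom.comp (Scheme.ΓSpecIso (.of k)).inv.hom)
    exact (φ.charP_iff_charP p).mp inferInstance
  haveI : ExpChar W.functionField p := ExpChar.prime hp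
  haveI : CharP W'.functionField p := (e.toRingHom.charP_iff_charP p).mp inferInstance
  haveI : ExpChar W'.functionField p := ExpChar.prime hp
  haveI : IsPurelyInseparable W'.functionField L := by
    rw [isPurelyInseparable_iff_pow_mem W'.functionField p]
    intro z
    obtain ⟨n, hn⟩ := (isPurelyInseparable_iff_pow_mem W.functionField p).mp hPI z
    exact ⟨n, hrange ▸ hn⟩
  -- the uniform normal form around the image point
  obtain ⟨U, hU, a, ⟨yL, c, hyK, hyp, hc⟩, hGU⟩ := hNF (ι.base y)
  haveI : Nonempty (U : W'.Opens) := ⟨⟨_, hU⟩⟩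
  have hyK' : yL ∉ (algebraMap W'.functionField L).range := hrange ▸ hyK
  have hyp' : yL ^ p = algebraMap W'.functionField L (W'.germToFunctionField (U : W'.Opens) a) := by
    rw [hyp, ← hcompat, RingHom.comp_apply, hc, Scheme.algebraMap_germ_eq_germToFunctionField]
  -- the cover-side package over every affine `V ≤ U`
  have hsecZ : ∀ (V : W'.affineOpens) (hV : (V : W'.Opens) ≤ U),
      Nonempty (ι ⁻¹ᵁ (V : W'.Opens)) → IsAffineOpen (ι ⁻¹ᵁ (V : W'.Opens)) ∧
      IsIntegrallyClosed Γ(normalizationIn W' L, ι ⁻¹ᵁ (V : W'.Opens)) ∧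
      (ι.app (V : W'.Opens)).hom.IsIntegral ∧ Function.Injective (ι.app (V : W'.Opens)) ∧
      ∃ t : Γ(normalizationIn W' L, ι ⁻¹ᵁ (V : W'.Opens)),
        t ^ p = ι.app (V : W'.Opens) (W'.presheaf.map (homOfLE hV).op a) ∧
        ∀ z : Γ(normalizationIn W' L, ι ⁻¹ᵁ (V : W'.Opens)), ∃ d : Γ(W', (V : W'.Opens)),
          d ≠ 0 ∧ ∃ P : Γ(W', (V : W'.Opens))[X],
            ι.app (V : W'.Opens) d * z = P.eval₂ (ι.app (V : W'.Opens)).hom t := by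
    intro V hV hne
    obtain ⟨⟨z, hz⟩⟩ := hne
    haveI : Nonempty (V : W'.Opens) := ⟨⟨ι.base z, hz⟩⟩
    have hypV : yL ^ p = algebraMap W'.functionField L
        (W'.germToFunctionField (V : W'.Opens) (W'.presheaf.map (homOfLE hV).op a)) := by
      rw [hyp', ← Scheme.algebraMap_germ_eq_germToFunctionField W' (hV hz),
        ← Scheme.algebraMap_germ_eq_germToFunctionField W' hz, germ_map_homOfLE]
    exact SectionsNormalizationInRoot.sections_normalizationIn_of_root p W' L hdeg' V _ yL hyK' hypV
  -- dispatch on the alternative of the normal form at the centre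
  haveI : LocallyOfFiniteType (ρ ≫ f) := inferInstance
  obtain ⟨r, D, x, hDbij, hDgen, hNFc⟩ := hGU (ι.base y) hU
  rcases hNFc with ⟨g₀, u₀, Bexp, hwt, ha⟩ | ⟨g₀, Aexp, v₀, ⟨j₀, hj₀⟩, ha⟩
  · exact LocalChartSepWoundCentre.localChartSep_woundCentre p k W' (ρ ≫ f) hW'reg E hE U a hGU
      (normalizationIn W' L) ι hsecZ y _ rfl hU D x hDbij hDgen g₀ u₀ Bexp hwt ha
  · exact LocalChartSepKummerCentre.localChartSep_kummerCentre p k W' (ρ ≫ f) hW'reg E hE U a hGU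
      (normalizationIn W' L) ι hsecZ y _ rfl hU D x hDbij hDgen g₀ Aexp v₀ j₀ hj₀ ha

/-- **The endgame atlas** (the strategist's `stub_endgameAtlasSep`, now a THEOREM modulo the
pointwise `stub_localChartsSep`; separated twin of the 0557 line's v4 `endgameAtlas`). Under the
endgame hypotheses and with `W` quasi-compact over `k`, the normalised cover
`W'^L = normalizationIn W' L` ITSELF is the log-regular model: `Y' := W'^L`, `ν := 𝟙` (proper,
birational), and `W'^L` — quasi-compact (`W` quasi-compact, `ρ` proper, `W'^L → W'` finite by
E. Noether / Liu 4.1.27, `isFinite_normalizationInι`) and locally Noetherian (locally of finite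
type over `k`) — carries the log-regular Zariski fs atlas glued from the local charts
(`logRegularAtlas_of_localLogRegularChart`, Kato (1.5)(S)). [folklore] -/
theorem endgameAtlasSep (p : ℕ) [Fact p.Prime] (k : Type) [Field k] [CharP k p]
    (W : Scheme.{0}) [IsIntegral W] (f : W ⟶ Spec (.of k)) [LocallyOfFiniteType f]
    [QuasiCompact f]
    (L : Type) [Field L] [Algebra W.functionField L] [FiniteDimensional W.functionField L]
    (W' : Scheme.{0}) [IsIntegral W'] (ρ : W' ⟶ W) [IsProper ρ] [IsDominant ρ]
    (E : List W'.IdealSheafData) [Algebra W'.functionField L]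
    (hcompat : (algebraMap W'.functionField L).comp (RatFn.functionFieldMap ρ) =
      algebraMap W.functionField L)
    (hbir : IsBirational ρ) (hW'reg : Scheme.IsRegular W') (hE : HasSNC E)
    (hPI : IsPurelyInseparable W.functionField L) (hdeg : Module.finrank W.functionField L = p)
    (hNF : ∀ w' : W', ∃ (U : W'.affineOpens) (hU : w' ∈ (U : W'.Opens)) (a : Γ(W', (U : W'.Opens))),
        (∃ (y : L) (c : W.functionField), y ∉ (algebraMap W.functionField L).range ∧
          y ^ p = algebraMap W.functionField L c ∧
          RatFn.functionFieldMap ρ c =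
            algebraMap (W'.presheaf.stalk w') W'.functionField
              (W'.presheaf.germ (U : W'.Opens) w' hU a)) ∧
        ∀ (w'' : W') (hw'' : w'' ∈ (U : W'.Opens)), ∃ (r : ℕ)
          (D : Fin r → {D : W'.IdealSheafData // D ∈ E ∧ w'' ∈ D.support})
          (x : Fin r → W'.presheaf.stalk w''), Function.Bijective D ∧
          (∀ j, stalkIdeal (D j).1 w'' = Ideal.span {x j}) ∧
          GiraudNormalFormAt p x (W'.presheaf.germ (U : W'.Opens) w'' hw'' a)) :
    ∃ (Y' : Scheme.{0}) (ν : Y' ⟶ normalizationIn W' L),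
      IsProper ν ∧ IsBirational ν ∧ Nonempty (LogRegularAtlas Y') := by
  -- `L` is finite over `K(W')` too (same degree, `ρ` birational)
  have hp : p.Prime := Fact.out
  have hbij : Function.Bijective (RatFn.functionFieldMap ρ) :=
    TowerTransport.bijective_functionFieldMap_of_isIso ρ hbir.isIso_stalkMap_genericPoint
  let e : W.functionField ≃+* W'.functionField := RingEquiv.ofBijective _ hbij
  have halg : algebraMap W'.functionField L =
      (algebraMap W.functionField L).comp e.symm.toRingHom := by
    refine RingHom.ext fun x => ?_
    rw [RingHom.comp_apply, ← hcompat, RingHom.comp_apply]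
    exact congrArg (algebraMap W'.functionField L) (e.apply_symm_apply x).symm
  have hdeg' : Module.finrank W'.functionField L = p := by
    rw [← hdeg]
    exact Algebra.finrank_eq_of_equiv_equiv e.symm (RingEquiv.refl L) (by ext x; simp [halg])
  haveI : FiniteDimensional W'.functionField L :=
    Module.finite_of_finrank_pos (by rw [hdeg']; exact hp.pos)
  -- `W'` is locally of finite type and quasi-compact over `k`, hence so is `W'^L`
  haveI : LocallyOfFiniteType (ρ ≫ f) := inferInstance
  haveI : IsFinite (normalizationInι W' L) := isFinite_normalizationInι W' L (ρ ≫ f)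
  haveI : CompactSpace ↥W := QuasiCompact.compactSpace_of_compactSpace f
  haveI : CompactSpace ↥W' := QuasiCompact.compactSpace_of_compactSpace ρ
  haveI : CompactSpace ↥(normalizationIn W' L) :=
    QuasiCompact.compactSpace_of_compactSpace (normalizationInι W' L)
  haveI : IsLocallyNoetherian (normalizationIn W' L) :=
    LocallyOfFiniteType.isLocallyNoetherian (normalizationInι W' L ≫ ρ ≫ f)
  -- the identity is the model; glue the local charts
  have hbir1 : IsBirational (𝟙 (normalizationIn W' L)) :=
    ⟨⊤, by simp [dense_univ], by simp [dense_univ], inferInstance⟩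
  refine ⟨normalizationIn W' L, 𝟙 _, inferInstance, hbir1, ?_⟩
  exact logRegularAtlas_of_localLogRegularChart _ _
    (localChartsSep p k W f L W' ρ E hcompat hbir hW'reg hE hPI hdeg hNF)

/-! ## Composition -/

/-- **The residue `PicoverDegP` from the Giraud normal form and Kato (10.4)** (conclusion verbatim = hypothesis of
`OfDegP.picover_of_picoverDegP`). Giraud normal form on a
regular modification `ρ : W' → W` (`stub_giraudNormalFormSep`); `L` is a `K(W')`-algebra through
the birational identification `K(W) ≅ K(W')`; the endgame atlas and Kato's theorem resolve
`W'^L`; the comparison `W'^L → W^L` is proper birational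
(`TowerTransport.hasResolution_normalizationIn_of_isProper`: the fibre of `ρ` over the generic
point is the generic point because `ρ` is an isomorphism over a dense open). [folklore] -/
theorem picoverDegP_of_giraudNormalFormSep_of_kato (hGNF : ∀ (p : ℕ), p.Prime → ∀ (k : Type) [Field k] [CharP k p]
    (W : Scheme.{0}) [IsIntegral W] (f : W ⟶ Spec (.of k)) (L : Type) [Field L]
    [Algebra W.functionField L], IsSeparated f → LocallyOfFiniteType f → QuasiCompact f →
    Scheme.IsRegular W → IsPurelyInseparable W.functionField L →
    Module.finrank W.functionField L = p →
    ∃ (W' : Scheme.{0}) (_ : IsIntegral W') (ρ : W' ⟶ W) (_ : IsDominant ρ)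
      (E : List W'.IdealSheafData),
      IsProper ρ ∧ IsBirational ρ ∧ Scheme.IsRegular W' ∧ HasSNC E ∧
      ∀ w' : W', ∃ (U : W'.affineOpens) (hU : w' ∈ (U : W'.Opens)) (a : Γ(W', (U : W'.Opens))),
        (∃ (y : L) (c : W.functionField), y ∉ (algebraMap W.functionField L).range ∧
          y ^ p = algebraMap W.functionField L c ∧
          RatFn.functionFieldMap ρ c =
            algebraMap (W'.presheaf.stalk w') W'.functionField
              (W'.presheaf.germ (U : W'.Opens) w' hU a)) ∧
        ∀ (w'' : W') (hw'' : w'' ∈ (U : W'.Opens)), ∃ (r : ℕ)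
          (D : Fin r → {D : W'.IdealSheafData // D ∈ E ∧ w'' ∈ D.support})
          (x : Fin r → W'.presheaf.stalk w''), Function.Bijective D ∧
          (∀ j, stalkIdeal (D j).1 w'' = Ideal.span {x j}) ∧
          GiraudNormalFormAt p x (W'.presheaf.germ (U : W'.Opens) w'' hw'' a))
    (hKato : Kato1994_logRegular_hasResolution_general.{0}) : ∀ (p : ℕ), p.Prime → ∀ (k : Type) [Field k] [CharP k p]
    (W : Scheme.{0}) [IsIntegral W] (f : W ⟶ Spec (.of k)) (L : Type) [Field L]
    [Algebra W.functionField L], IsSeparated f → LocallyOfFiniteType f → QuasiCompact f →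
    Scheme.IsRegular W → IsPurelyInseparable W.functionField L →
    Module.finrank W.functionField L = p → Scheme.HasResolution (normalizationIn W L) := by
  intro p hp k _ _ W _ f L _ _ hsep hlft hqc hWreg hPI hdeg
  haveI : Fact p.Prime := ⟨hp⟩
  haveI : LocallyOfFiniteType f := hlft
  haveI : QuasiCompact f := hqc
  haveI : FiniteDimensional W.functionField L :=
    Module.finite_of_finrank_pos (by rw [hdeg]; exact hp.pos)
  -- THE RESIDUE: Giraud normal form of the class of `L` on a regular modification `W'` of `W`
  obtain ⟨W', hW'int, ρ, hdom, E, hρ, hbir, hW'reg, hE, hNF⟩ :=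
    hGNF p hp k W f L hsep hlft hqc hWreg hPI hdeg
  haveI := hρ
  -- `L` as a `K(W')`-algebra through the birational identification `ρ^♯ : K(W) ≅ K(W')`
  have hbij : Function.Bijective (RatFn.functionFieldMap ρ) :=
    TowerTransport.bijective_functionFieldMap_of_isIso ρ hbir.isIso_stalkMap_genericPoint
  let e : W.functionField ≃+* W'.functionField := RingEquiv.ofBijective _ hbij
  letI : Algebra W'.functionField L :=
    ((algebraMap W.functionField L).comp e.symm.toRingHom).toAlgebra
  have halg : algebraMap W'.functionField L =
      (algebraMap W.functionField L).comp e.symm.toRingHom := rfl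
  have hcompat : (algebraMap W'.functionField L).comp (RatFn.functionFieldMap ρ) =
      algebraMap W.functionField L := by
    refine RingHom.ext fun x => ?_
    rw [halg, RingHom.comp_apply, RingHom.comp_apply]
    exact congrArg (algebraMap W.functionField L) (e.symm_apply_apply x)
  -- THE ENDGAME, algebraic half: a log-regular atlas on a proper birational model of `W'^L`
  obtain ⟨Y', ν, hν, hνbir, ⟨atlas⟩⟩ :=
    endgameAtlasSep p k W f L W' ρ E hcompat hbir hW'reg hE hPI hdeg hNF
  haveI := hν
  -- THE ENDGAME, resolution half: Kato 1994 (10.4), then down the proper birational `ν`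
  have hres' : Scheme.HasResolution (normalizationIn W' L) :=
    Scheme.HasResolution.of_isBirational ν hνbir (hKato Y' ⟨atlas⟩)
  -- finiteness of `L` over `K(W')` (same degree `p`)
  have hdeg' : Module.finrank W'.functionField L = p := by
    rw [← hdeg]
    exact Algebra.finrank_eq_of_equiv_equiv e.symm (RingEquiv.refl L) (by ext x; simp [halg])
  haveI : FiniteDimensional W'.functionField L :=
    Module.finite_of_finrank_pos (by rw [hdeg']; exact hp.pos)
  -- the fibre of `ρ` over the generic point of `W` is the generic point of `W'`
  have hfib : ∀ w' : W', ρ w' = genericPoint W → w' = genericPoint W' := by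
    intro w' hw'
    obtain ⟨U, hU, -, hUiso⟩ := hbir
    haveI := hUiso
    have hηU : genericPoint W ∈ U :=
      ((genericPoint_spec W).mem_open_set_iff U.isOpen).mpr (by simpa using hU.nonempty)
    exact TowerTransport.subsingleton_preimage_of_isIso_morphismRestrict ρ U hηU hw'
      (RatFn.genericPoint_eq_of_isDominant ρ)
  -- TRANSPORT down the proper birational comparison `W'^L → W^L` (tree)
  exact TowerTransport.hasResolution_normalizationIn_of_isProper
    FunctionFieldNormalizationIn.stub_functionField_normalizationIn W f L W' ρ hcompat hfib hres'

/-- **The conditional bridge**: `Picover` BY NAME from Giraud's normal-form conjecture (uniform-sections format, the registered research stub of the line) and Kato 1994 (10.4), through the landed frame `OfDegP.picover_of_picoverDegP` (crux ⟸ degree-`p` residue). [folklore] -/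
theorem picover_of_giraudNormalFormSep_of_kato : (∀ (p : ℕ), p.Prime → ∀ (k : Type) [Field k] [CharP k p]
    (W : Scheme.{0}) [IsIntegral W] (f : W ⟶ Spec (.of k)) (L : Type) [Field L]
    [Algebra W.functionField L], IsSeparated f → LocallyOfFiniteType f → QuasiCompact f →
    Scheme.IsRegular W → IsPurelyInseparable W.functionField L →
    Module.finrank W.functionField L = p →
    ∃ (W' : Scheme.{0}) (_ : IsIntegral W') (ρ : W' ⟶ W) (_ : IsDominant ρ)
      (E : List W'.IdealSheafData),
      IsProper ρ ∧ IsBirational ρ ∧ Scheme.IsRegular W' ∧ HasSNC E ∧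
      ∀ w' : W', ∃ (U : W'.affineOpens) (hU : w' ∈ (U : W'.Opens)) (a : Γ(W', (U : W'.Opens))),
        (∃ (y : L) (c : W.functionField), y ∉ (algebraMap W.functionField L).range ∧
          y ^ p = algebraMap W.functionField L c ∧
          RatFn.functionFieldMap ρ c =
            algebraMap (W'.presheaf.stalk w') W'.functionField
              (W'.presheaf.germ (U : W'.Opens) w' hU a)) ∧
        ∀ (w'' : W') (hw'' : w'' ∈ (U : W'.Opens)), ∃ (r : ℕ)
          (D : Fin r → {D : W'.IdealSheafData // D ∈ E ∧ w'' ∈ D.support})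
          (x : Fin r → W'.presheaf.stalk w''), Function.Bijective D ∧
          (∀ j, stalkIdeal (D j).1 w'' = Ideal.span {x j}) ∧
          GiraudNormalFormAt p x (W'.presheaf.germ (U : W'.Opens) w'' hw'' a)) → Kato1994_logRegular_hasResolution_general.{0} → Summit.ResolutionOfSingularities.ResolutionOfSingularities.Theses.PAlteration.Picover :=
  fun hGNF hKato => OfDegP.picover_of_picoverDegP (picoverDegP_of_giraudNormalFormSep_of_kato hGNF hKato)

end Summit.ResolutionOfSingularities.ResolutionOfSingularities.Theorems.Picover.GiraudSepReduction

end
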